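import Summits.Parity.GeneralizedHardyLittlewood.Theorems.GreenTaoLevelTwoGITwoCyclicInverseLocalBogolyubovCount
import Summits.Parity.GeneralizedHardyLittlewood.Theorems.GreenTaoLevelTwoGITwoCyclicInverseLocalBogolyubovPrelims
import Summits.Parity.GeneralizedHardyLittlewood.Theorems.GreenTaoLevelTwoGITwoCyclicInverseLocalBesselDual
import Summits.Parity.GeneralizedHardyLittlewood.Theorems.GreenTaoLevelTwoGITwoCyclicInverseBohrRegular
import Summits.Parity.GeneralizedHardyLittlewood.Theorems.GreenTaoLevelTwoGITwoCyclicInverseBohrAveraging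

/-!
# Route `GreenTaoLevelTwo`, crux `GITwo` (stmt-Parity-21275), line `birth`, stub `stub_cyclicInverse`:
# the local Bogolyubov lemma (GT08a arXiv Lemma 42)

Thirty-fourth helper file toward the XL stub `stub_cyclicInverse` (B. Green, T. Tao, *An inverse
theorem for the Gowers `U³(G)` norm*, arXiv:math/0503014, Thm. 68 = PEMS 51 (2008) Thm. 12.8).
Block B8, arXiv Lemma 42, assembled from the landed bricks: regular radii (`exists_regular_bohr`,
Lemma 36), averaging (`exists_shift_avg_ge_of_regular`, Lemma 21 (iii)), the dual local Bessel
inequality (`exists_cover_largeSpec`, Cor. 41) and the counting core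
(`exists_mixed_repr_of_re_ge_half`).  Statement (polynomial constants, slightly different from the
printed ones — see the docstring of the theorem): for `S` nonempty (`d = #S`), `B = B(S,ρ)` regular and
`A ⊆ B` with `#A ≥ δ #B` (`0 < δ ≤ 1`) there are a radius `ρ' ≥ δρ/(800d)` and a set `F` of at most
`128/δ⁴` frequencies such that every `z` with `‖zξ‖ < δ⁸ρ'/(2³²d)` (`ξ ∈ S`) and `‖zζ‖ ≤ 1/12`
(`ζ ∈ F`) lies in `2A − 2A`; in particular `B(S ∪ F, δ⁹ρ/(2⁴²d²)) ⊆ 2A − 2A`.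

* `local_bogolyubov` — **arXiv Lemma 42** in the form just described.

References: [GreenTao2008U3Inverse] arXiv:math/0503014, Lemma 42.
-/

noncomputable section

open Finset ZMod
open scoped BigOperators ComplexConjugate Combinatorics.Additive Pointwise

namespace Summit.Parity.GeneralizedHardyLittlewood.GreenTaoLevelTwoGITwoCyclicInverse

open Literature.NumberTheory.Sieve

variable {N : ℕ} [NeZero N]

/-- **Local Bogolyubov lemma (GT08a arXiv Lemma 42).**  Let `S ⊆ ℤ/Nℤ` be nonempty (`d = #S`),
`ρ > 0`, `B = B(S,ρ) = {x : ‖toAddCircle(xξ)‖ < ρ ∀ ξ ∈ S}` regular (arXiv Def. 16), and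
`A ⊆ B` with `#A ≥ δ #B`, `0 < δ ≤ 1`.  Then there are `ρ' ≥ δρ/(800 d)` and a finset `F` of
frequencies with `#F ≤ 128/δ⁴` such that every `z` with `‖toAddCircle(zξ)‖ < δ⁸ρ'/(2³² d)` for
`ξ ∈ S` and `‖toAddCircle(zζ)‖ ≤ 1/12` for `ζ ∈ F` is of the form `(a − c) + (a' − c')` with
`a, c, a', c' ∈ A` (so `B(S ∪ F, δ⁸ρ'/(2³²d)) ⊆ 2A − 2A`; the paper: `#S' ≤ 2⁷δ⁻³`, radius
`2⁻³³δ⁶ρ/d`). [cite: GreenTao2008U3Inverse, Lemma 42] -/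
theorem local_bogolyubov (S : Finset (ZMod N)) (hS : S.Nonempty) {ρ δ : ℝ} (hρ : 0 < ρ)
    (hδ : 0 < δ) (hδ1 : δ ≤ 1)
    (hreg : ∀ κ : ℝ, |κ| ≤ 1 / (100 * (#S : ℝ)) →
      (1 - 100 * (#S : ℝ) * |κ|) * #{x : ZMod N | ∀ ξ ∈ S, ‖ZMod.toAddCircle (x * ξ)‖ < ρ} ≤
          #{x : ZMod N | ∀ ξ ∈ S, ‖ZMod.toAddCircle (x * ξ)‖ < (1 + κ) * ρ} ∧
        (#{x : ZMod N | ∀ ξ ∈ S, ‖ZMod.toAddCircle (x * ξ)‖ < (1 + κ) * ρ} : ℝ) ≤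
          (1 + 100 * (#S : ℝ) * |κ|) * #{x : ZMod N | ∀ ξ ∈ S, ‖ZMod.toAddCircle (x * ξ)‖ < ρ})
    {A : Finset (ZMod N)}
    (hA : A ⊆ ({x : ZMod N | ∀ ξ ∈ S, ‖ZMod.toAddCircle (x * ξ)‖ < ρ} : Finset (ZMod N)))
    (hAcard : δ * #{x : ZMod N | ∀ ξ ∈ S, ‖ZMod.toAddCircle (x * ξ)‖ < ρ} ≤ #A) :
    ∃ (ρ' : ℝ) (F : Finset (ZMod N)), δ / (800 * (#S : ℝ)) * ρ ≤ ρ' ∧ (#F : ℝ) ≤ 128 / δ ^ 4 ∧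
      ∀ z : ZMod N, (∀ ξ ∈ S, ‖ZMod.toAddCircle (z * ξ)‖ < δ ^ 8 / (2 ^ 32 * (#S : ℝ)) * ρ') →
        (∀ ζ ∈ F, ‖ZMod.toAddCircle (z * ζ)‖ ≤ 1 / 12) →
          ∃ a ∈ A, ∃ c ∈ A, ∃ a' ∈ A, ∃ c' ∈ A, a - c + (a' - c') = z := by
  classical
  set B : Finset (ZMod N) := {x : ZMod N | ∀ ξ ∈ S, ‖ZMod.toAddCircle (x * ξ)‖ < ρ} with hBdef
  have hB : ∀ x, x ∈ B ↔ ∀ ξ ∈ S, ‖ZMod.toAddCircle (x * ξ)‖ < ρ := fun x => by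
    rw [hBdef, mem_filter]; simp
  have hd1 : (1 : ℝ) ≤ #S := by
    exact_mod_cast Nat.one_le_iff_ne_zero.mpr (card_pos.mpr hS).ne'
  have hNpos : (0 : ℝ) < N := by exact_mod_cast Nat.pos_of_ne_zero (NeZero.ne N)
  have hc1 : (1 : ℝ) ≤ #B := by exact_mod_cast one_le_card_bohr S hρ
  have hc0 : (0 : ℝ) < #B := by linarith
  have hBne : B.Nonempty := by
    rw [← card_pos]
    have : (0 : ℝ) < #B := hc0
    exact_mod_cast this
  have hApos : (0 : ℝ) < #A := lt_of_lt_of_le (mul_pos hδ hc0) hAcard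
  -- the regular radius `ρ' ∈ [ερ, 2ερ]`, `ε = δ/(800 d)`
  set ε : ℝ := δ / (800 * (#S : ℝ)) with hε
  have hε0 : 0 < ε := by positivity
  obtain ⟨ρ', hρ'1, hρ'2, hreg'⟩ := exists_regular_bohr S (ε := ε * ρ) (by positivity)
  have hρ'0 : 0 < ρ' := lt_of_lt_of_le (by positivity) hρ'1
  set ε' : ℝ := ρ' / ρ with hε'
  have hε'ρ : ε' * ρ = ρ' := by rw [hε']; field_simp
  have hε'0 : 0 < ε' := by positivity
  have hε'le : ε' ≤ 2 * ε := by
    rw [hε', div_le_iff₀ hρ]; linarith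
  have h200 : 200 * (#S : ℝ) * ε' ≤ δ / 2 := by
    calc 200 * (#S : ℝ) * ε' ≤ 200 * (#S : ℝ) * (2 * ε) :=
          mul_le_mul_of_nonneg_left hε'le (by positivity)
      _ = δ / 2 := by rw [hε]; field_simp; ring
  have hε'100 : ε' ≤ 1 / (100 * (#S : ℝ)) := by
    rw [le_div_iff₀ (by positivity)]
    nlinarith
  -- `B' = B(S,ρ')`, `B± = B(S,(1±ε')ρ)` and regularity of `B` at `κ = ±ε'`
  set B' : Finset (ZMod N) := {x : ZMod N | ∀ ξ ∈ S, ‖ZMod.toAddCircle (x * ξ)‖ < ρ'} with hB'def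
  have hB'1 : (1 : ℝ) ≤ #B' := by exact_mod_cast one_le_card_bohr S hρ'0
  set Bp : Finset (ZMod N) := {x : ZMod N | ∀ ξ ∈ S, ‖ZMod.toAddCircle (x * ξ)‖ < (1 + ε') * ρ}
    with hBpdef
  set Bm : Finset (ZMod N) := {x : ZMod N | ∀ ξ ∈ S, ‖ZMod.toAddCircle (x * ξ)‖ < (1 - ε') * ρ}
    with hBmdef
  have hBp : ∀ x, x ∈ Bp ↔ ∀ ξ ∈ S, ‖ZMod.toAddCircle (x * ξ)‖ < (1 + ε') * ρ := fun x => by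
    rw [hBpdef, mem_filter]; simp
  have hBm : ∀ x, x ∈ Bm ↔ ∀ ξ ∈ S, ‖ZMod.toAddCircle (x * ξ)‖ < (1 - ε') * ρ := fun x => by
    rw [hBmdef, mem_filter]; simp
  have hregp : (#Bp : ℝ) ≤ (1 + 100 * (#S : ℝ) * ε') * #B := by
    have h := (hreg ε' (by rw [abs_of_pos hε'0]; exact hε'100)).2
    rw [abs_of_pos hε'0] at h
    exact h
  have hregm : (1 - 100 * (#S : ℝ) * ε') * #B ≤ (#Bm : ℝ) := by
    have h := (hreg (-ε') (by rw [abs_neg, abs_of_pos hε'0]; exact hε'100)).1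
    rw [abs_neg, abs_of_pos hε'0, ← sub_eq_add_neg] at h
    exact h
  -- arXiv Lemma 21 (iii): a translate `x₁ + B'` on which `A` has density `≥ δ/2`
  have hA_small : ∀ y ∈ B', ∀ ξ ∈ S, ‖ZMod.toAddCircle (y * ξ)‖ ≤ ε' * ρ := by
    intro y hy ξ hξ
    rw [hB'def, mem_filter] at hy
    rw [hε'ρ]
    exact (hy.2 ξ hξ).le
  have hf : ∀ y : ZMod N, |(fun y => if y ∈ A then (1 : ℝ) else 0) y| ≤ 1 := fun y => by
    simp only; split_ifs <;> simp
  obtain ⟨x₁, -, hx₁⟩ :=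
    exists_shift_avg_ge_of_regular hB hBp hBm hS hA_small hregp hregm hBne hf
  set A'' : Finset (ZMod N) := B'.filter (fun y => x₁ + y ∈ A) with hA''def
  have hsumB : ∑ y ∈ B, (fun y => if y ∈ A then (1 : ℝ) else 0) y = #A := by
    simp only
    rw [Finset.sum_boole, Finset.filter_mem_eq_inter, inter_eq_right.mpr hA]
  have hsumB' : ∑ y ∈ B', (fun y => if y ∈ A then (1 : ℝ) else 0) (x₁ + y) = #A'' := by
    simp only
    rw [Finset.sum_boole]
  rw [hsumB, hsumB'] at hx₁
  have hA''card : δ / 2 * #B' ≤ #A'' := by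
    have h1 : (#B' : ℝ) * (δ * #B) ≤ #B' * #A := mul_le_mul_of_nonneg_left hAcard (Nat.cast_nonneg _)
    have h2 := mul_le_mul_of_nonneg_right h200
      (mul_nonneg (Nat.cast_nonneg _) (Nat.cast_nonneg _) : (0 : ℝ) ≤ #B' * #B)
    refine le_of_mul_le_mul_left ?_ hc0
    linarith
  have hA''sub : A'' ⊆ B' := filter_subset _ _
  have hA''A : ∀ y ∈ A'', x₁ + y ∈ A := fun y hy => (mem_filter.mp hy).2
  -- arXiv Cor. 41 for `A'' ⊆ B'` with `η = δ²/8`, `τ = δ⁸/(2³² d)`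
  set τ : ℝ := δ ^ 8 / (2 ^ 32 * (#S : ℝ)) with hτ
  have hτ0 : 0 < τ := by positivity
  set η : ℝ := δ ^ 2 / 8 with hη
  have hη0 : 0 < η := by positivity
  obtain ⟨F, hFcard, hcover⟩ := exists_cover_largeSpec S hS hρ'0 hτ0 hη0 hreg' (A := A'') hA''sub
  have hrad : 2 ^ 16 * τ * (#S : ℝ) / η ^ 4 = 1 / 16 := by
    rw [hτ, hη]; field_simp; ring
  refine ⟨ρ', F, hρ'1, ?_, fun z hzS hzF => ?_⟩
  · refine hFcard.trans (le_of_eq ?_)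
    rw [hη]; field_simp; ring
  -- the spectral condition for `z`
  have hx : ∀ ξ : ZMod N, η * #B' / N ≤ ‖dftCoeff (fun y => if y ∈ A'' then (1 : ℝ) else 0) ξ‖ →
      1 / 2 ≤ (stdAddChar (z * ξ) : ℂ).re := by
    intro ξ hξ
    have hlarge : η * #B' ≤ ‖∑ y ∈ A'', (stdAddChar (y * ξ) : ℂ)‖ := by
      rw [norm_sum_stdAddChar_eq_norm_dftCoeff]
      have := mul_le_mul_of_nonneg_left hξ hNpos.le
      rwa [mul_div_cancel₀ _ hNpos.ne'] at this
    obtain ⟨ζ', hζ'F, hnear⟩ := hcover ξ hlarge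
    have h1 : ‖ZMod.toAddCircle (z * (ξ - ζ'))‖ ≤ 1 / 16 := by
      rw [← hrad]; exact hnear z hzS
    have h2 : ‖ZMod.toAddCircle (z * ζ')‖ ≤ 1 / 12 := hzF ζ' hζ'F
    have h3 : ‖ZMod.toAddCircle (z * ξ)‖ ≤ 1 / 6 := by
      have : z * ξ = z * (ξ - ζ') + z * ζ' := by ring
      rw [this, map_add]
      exact (norm_add_le _ _).trans (by linarith)
    exact half_le_re_stdAddChar_of_norm_le _ h3
  -- the size condition
  have hAA : (#(A + A'') : ℝ) ≤ 2 * #B := by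
    have hsub : A + A'' ⊆ Bp := by
      intro x hx
      have hx' := add_subset_bohr_add S A A'' (ρ := ρ) (ρ' := ρ')
        (fun a ha => (hB a).mp (hA ha)) (fun a ha => by
          have := hA''sub ha
          rw [hB'def, mem_filter] at this
          exact this.2) hx
      rw [mem_filter] at hx'
      rw [hBp]
      intro ξ hξ
      have := hx'.2 ξ hξ
      rw [add_mul, one_mul, hε'ρ]; exact this
    have h1 : (#(A + A'') : ℝ) ≤ #Bp := by exact_mod_cast card_le_card hsub
    have h2 : 100 * (#S : ℝ) * ε' ≤ 1 := by
      have := hε'100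
      rw [le_div_iff₀ (by positivity)] at this
      linarith
    have h3 := mul_le_mul_of_nonneg_right h2 hc0.le
    linarith [hregp, hc0, h3]
  have ht2 : (η * #B' / N) ^ 2 * (N : ℝ) ^ 2 = η ^ 2 * (#B' : ℝ) ^ 2 := by
    field_simp
  have hB'0 : (0 : ℝ) < #B' := by linarith
  have hX : 0 < (#B' : ℝ) ^ 2 * #A * #B := mul_pos (mul_pos (pow_pos hB'0 2) hApos) hc0
  have hL : 3 * (η * #B' / N) ^ 2 * (N : ℝ) ^ 2 * #A * #(A + A'') ≤
      6 * η ^ 2 * ((#B' : ℝ) ^ 2 * #A * #B) := by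
    calc 3 * (η * #B' / N) ^ 2 * (N : ℝ) ^ 2 * #A * #(A + A'')
        = 3 * (η ^ 2 * (#B' : ℝ) ^ 2) * #A * #(A + A'') := by rw [← ht2]; ring
      _ ≤ 3 * (η ^ 2 * (#B' : ℝ) ^ 2) * #A * (2 * #B) :=
          mul_le_mul_of_nonneg_left hAA
            (mul_nonneg (mul_nonneg (by norm_num) (mul_nonneg (sq_nonneg _) (sq_nonneg _)))
              (Nat.cast_nonneg _))
      _ = 6 * η ^ 2 * ((#B' : ℝ) ^ 2 * #A * #B) := by ring
  have hmid : 6 * η ^ 2 < δ ^ 3 / 4 := by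
    have hδ3 : 0 < δ ^ 3 := pow_pos hδ 3
    have h4 : δ ^ 4 ≤ δ ^ 3 := by
      calc δ ^ 4 = δ ^ 3 * δ := by ring
        _ ≤ δ ^ 3 * 1 := mul_le_mul_of_nonneg_left hδ1 hδ3.le
        _ = δ ^ 3 := mul_one _
    have h5 : 6 * η ^ 2 = 3 / 32 * δ ^ 4 := by rw [hη]; ring
    rw [h5]
    linarith
  have hR : δ ^ 3 / 4 * ((#B' : ℝ) ^ 2 * #A * #B) ≤ (#A : ℝ) ^ 2 * (#A'' : ℝ) ^ 2 := by
    have h3 : (δ / 2 * #B') ^ 2 ≤ (#A'' : ℝ) ^ 2 :=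
      pow_le_pow_left₀ (mul_nonneg (by positivity) (Nat.cast_nonneg _)) hA''card 2
    calc δ ^ 3 / 4 * ((#B' : ℝ) ^ 2 * #A * #B) = #A * (δ * #B) * (δ / 2 * #B') ^ 2 := by ring
      _ ≤ #A * #A * (#A'' : ℝ) ^ 2 := by
          apply mul_le_mul _ h3 (sq_nonneg _) (mul_nonneg (Nat.cast_nonneg _) (Nat.cast_nonneg _))
          exact mul_le_mul_of_nonneg_left hAcard (Nat.cast_nonneg _)
      _ = (#A : ℝ) ^ 2 * (#A'' : ℝ) ^ 2 := by ring
  have hsmall : 3 * (η * #B' / N) ^ 2 * (N : ℝ) ^ 2 * #A * #(A + A'') <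
      (#A : ℝ) ^ 2 * (#A'' : ℝ) ^ 2 :=
    lt_of_le_of_lt hL (lt_of_lt_of_le (mul_lt_mul_of_pos_right hmid hX) hR)
  obtain ⟨a, ha, c, hc, a'', ha'', c'', hc'', heq⟩ :=
    exists_mixed_repr_of_re_ge_half A A'' z hx hsmall
  exact ⟨a, ha, c, hc, x₁ + a'', hA''A _ ha'', x₁ + c'', hA''A _ hc'', by rw [← heq]; ring⟩

end Summit.Parity.GeneralizedHardyLittlewood.GreenTaoLevelTwoGITwoCyclicInverse
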